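import Literature.Computability.Complexity.EncodingFrames
import Literature.Computability.Complexity.HashBricks
import Literature.Computability.QuantumComplexity.ExactBosonSamplingHardness
import HarnessLib

/-!
# Exact BosonSampling: the hard instances as explicit strings (codes for the reduction machine)

Companion to `ExactBosonSamplingHardness.lean` (Aaronson–Arkhipov, *The computational complexity
of linear optics*, Theory of Computing 9 (2013), proof of Thm. 1.1, p. 178, for the tree's
exact-dyadic instance family: the Gram completion `gramEntries X t` of an integer matrix `X` and
the planted outcome).

**What this serves, and what it does not.** The corrected S20
(`PSharpP_subset_BPPRelClass_NP_of_uniformExactBosonSampling`) is proved in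
`PermanentSearchRandom.lean` (`…_of_AA13`) from, among others, the named fact
`bosonReduction_mem_FP` (`ExactBosonSamplingHardness.lean`): the reduction maps `bosonPre`,
`bosonCountQuery`, `bosonCountPost` are in `FP`. Those maps are pinned to the precision
`gramPrecision X = ⌊log₄ Σ pairDiag⌋ + 1` and, being defined through `encodingIntMatrix.decode` and
`Computability.decodeNat`, have a definite junk behaviour on *malformed* strings that a machine
discharging `bosonReduction_mem_FP` literally would have to reproduce bit for bit. The follow-up
files do **not** discharge that fact. Instead they carry out a **re-based reduction** — option (a)
of the review of this file: `BosonReductionMachine.lean` defines new reduction maps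
`BosonFP.bPre/bQuery/bPost` *as* polynomial-time string functions (brick algebra, `FP` by
construction) whose values are proved only on well-formed `Per²`-queries, the instance being the
*same* family `gramInstanceCode (Matrix.of X) t` / `diagOutcomeCode n t` but at the precision
`t = 3 |⟨X⟩|` read off the input length; and `BosonReductionAssembly.lean` re-proves, for these
maps, the two consumers of `bosonPre_encode` + admissibility in `ExactBosonSamplingHardness.lean`
(`bosonRescale_mem_perSqWindow`, `perSqRandOracleSolves_bosonPerSqOracle`) and hence the corrected
S20 from Stockmeyer's theorem (discharged), Valiant's theorem and the running-time fact of the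
Thm-4.3 search alone. `bosonReduction_mem_FP` stays in the tree as an unused named fact.

The machine produces the instance and outcome codes piece by piece, indexing rows and columns by
*natural numbers* held in unary. This file is the bridge between that view and the `Fin`-indexed
definitions:

* `ℕ`-indexed arithmetic of the completion: `xAt X i j` (entries, `0` off range), `gramAt`
  (`= colGram`), its sign-split into two natural sums `gramP`/`gramQ` (`gramAt = gramP - gramQ`,
  which is how a machine with natural-number arithmetic computes a sum of signed products),
  `pairDiagN` (`= pairDiag`), `deficitN` (`= gramDeficit`), and the three kinds of cells
  `cellXv`, `cellPv`, `cellVv` (`= gramRows` on the three kinds of rows);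
* the codes as concatenations: `intCode`, `cellCode`, `frame1`, `rowFrame`, and
  **`gramInstanceCode_eq`**: the instance code is `⟨bin n, ⟨bin e, ⟨bin t, ⟨1^{n+e}, PX ++ PP ++ PV⟩⟩⟩⟩`
  with the three row blocks `partXs`, `partPs`, `partVs` written as iterated `ccat`s
  (`EncodingFrames.lean`) of row frames — the block `X`, the pair rows `(a, b)` in row-major order,
  the private rows `(a, lvl, l)` in that nesting order (the order of `gramRowEquiv`, via
  `finSumFinEquiv`/`finProdFinEquiv`); `diagOutcomeCode_eq`; `encode_matrix_eq` (the query's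
  matrix code as nested pairs) — all valid at *every* precision `t`;
* **an admissible precision for the re-based reduction**: `pairDiag_le_four_pow`
  (`pairDiag X j ≤ 4^{3 |⟨X⟩|}`, since entries are below `2^{|⟨X⟩|}` and `n ≤ |⟨X⟩|`). All it gives is
  the hypothesis `∀ j, pairDiag X j ≤ 4^t` of `isColumnOrthonormal_gram` and
  `toReal_bosonSamplingProblem_gramInstance` at `t = 3 |⟨X⟩|`; it says nothing about `bosonPre`
  (pinned to `gramPrecision`), whose `FP`-membership is neither used nor proved downstream;
* size bounds used to show that the machine's clipped loops do not clip (`length_intCode_le_codeLen`, …).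

## References

* S. Aaronson, A. Arkhipov, *The computational complexity of linear optics*, Theory of Computing 9
  (2013), Lemma 4.4 and proof of Thm. 1.1, eqs. (4.20)–(4.23) (p. 178).
* S. Arora, B. Barak, *Computational Complexity: A Modern Approach*, CUP 2009, §0.1
  (representations of tuples and matrices as strings).
-/

open Computability Literature.Computability.Complexity Literature.Computability.Complexity.OracleCompose Finset

namespace Literature.Computability.QuantumComplexity

namespace BosonCodes

variable {n : ℕ}

/-! ### Codes of integers, cells, frames -/

/-- The code of an integer (`encodingIntBool`): sign bit paired with the binary magnitude. An
`abbrev`, so that `simp`/`rw` users see `encodingIntBool.encode`; the unfolding and length lemmas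
below are the `encodeInt` / `encodingIntBool_encode` / `length_encodingIntBool_encode` of
`Algebra/EuclideanLattices/Encoding.lean` and `GapCVPPrime.lean` (cross-trunk, not importable here;
hoist candidates for `Complexity/BoolEncodings.lean`). [cite: AroraBarakCC2009, §0.1] -/
abbrev intCode (z : ℤ) : List Bool := encodingIntBool.encode z

/-- `intCode z = ⟨[z < 0], bin |z|⟩`. [folklore] -/
theorem intCode_eq (z : ℤ) : intCode z = boolPair [decide (z < 0)] (encodeNat z.natAbs) := rfl

/-- Length of an integer code: `4 + |bin |z||`. [folklore] -/
@[simp] theorem length_intCode (z : ℤ) : (intCode z).length = (encodeNat z.natAbs).length + 4 := by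
  rw [intCode_eq, length_boolPair]; simp; omega

/-- The code of a cell `(z, 0)` of a BosonSampling instance (real part `z`, imaginary part `0`). [folklore] -/
def cellCode (z : ℤ) : List Bool := boolPair (intCode z) (intCode 0)

/-- `cellCode` is the `pairBool` code of `(z, 0)`. [folklore] -/
theorem pairInt_encode (z : ℤ) : (encodingIntBool.pairBool encodingIntBool).encode (z, 0) = cellCode z := rfl

/-- `intCode 0 = ⟨[0], ε⟩ = 0001`. [folklore] -/
theorem intCode_zero : intCode 0 = [false, false, false, true] := rfl

/-- Length of a cell code. [folklore] -/
@[simp] theorem length_cellCode (z : ℤ) : (cellCode z).length = 2 * (encodeNat z.natAbs).length + 14 := by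
  rw [cellCode, length_boolPair, length_intCode, intCode_zero]; simp; omega

/-- The frame of one item of a nested-pair list: `frame1 w = ⟨w, ε⟩` (the code of a list is the
concatenation of the frames of its items). [folklore] -/
def frame1 (w : List Bool) : List Bool := boolPair w []

/-- `frame1 w = dbl w ++ 01`. [folklore] -/
theorem frame1_eq (w : List Bool) : frame1 w = Com.repBits 2 w ++ [false, true] := by
  rw [frame1, boolPair_eq, List.append_nil]

/-- Length of a frame. [folklore] -/
@[simp] theorem length_frame1 (w : List Bool) : (frame1 w).length = 2 * w.length + 2 := by
  simp [frame1]

/-- The framed code of `List.ofFn` is the `ccat` of the frames. [folklore] -/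
theorem frames_ofFn_eq_ccat (c : ℕ → List Bool) (m : ℕ) :
    frames (List.ofFn fun i : Fin m => c i) = ccat (fun i => frame1 (c i)) m := by
  rw [frames_ofFn]; simp only [frame1_eq]

/-- `frames` is `body` (the folds of `EncodingFrames.lean` and `CookReducibilityTransitive.lean` agree). [folklore] -/
theorem frames_eq_body (l : List (List Bool)) : frames l = body l := by
  induction l with
  | nil => rfl
  | cons a l ih => rw [frames_cons_eq_boolPair, body_cons, ih]

/-- The frames of a concatenation of lists. [folklore] -/
theorem frames_flatten (L : List (List (List Bool))) : frames L.flatten = (L.map frames).flatten := by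
  induction L with
  | nil => rfl
  | cons l L ih => rw [List.flatten_cons, frames_append, ih, List.map_cons, List.flatten_cons]

/-- A flattened `List.ofFn` is a `ccat`. [folklore] -/
theorem flatten_ofFn_eq_ccat (g : ℕ → List Bool) : ∀ m : ℕ,
    (List.ofFn fun i : Fin m => g i).flatten = ccat g m
  | 0 => rfl
  | m + 1 => by
    rw [List.ofFn_succ', List.concat_eq_append, List.flatten_append]
    simp only [Fin.val_castSucc, Fin.val_last, List.flatten_cons, List.flatten_nil, List.append_nil]
    rw [flatten_ofFn_eq_ccat g m, ccat_succ]

/-- A flattened `List.ofFn` whose items are given by an `ℕ`-indexed function is a `ccat`. [folklore] -/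
theorem flatten_ofFn_eq_ccat' {m : ℕ} {F : Fin m → List Bool} {g : ℕ → List Bool} (h : ∀ a : Fin m, F a = g a) :
    (List.ofFn F).flatten = ccat g m := by
  rw [← flatten_ofFn_eq_ccat g m]
  congr 1
  exact List.ofFn_inj.2 (funext h)

/-- An item is no longer than the framed list containing it. [folklore] -/
theorem length_le_length_frames_of_mem {c : List Bool} {l : List (List Bool)} (h : c ∈ l) :
    c.length ≤ (frames l).length := by
  induction l with
  | nil => simp at h
  | cons a l ih =>
    rw [frames_cons, List.length_append, List.length_append, Com.length_repBits]
    rcases List.mem_cons.1 h with rfl | h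
    · omega
    · have := ih h; omega

/-- An item is no longer than the nested-pair list containing it. [folklore] -/
theorem length_le_length_body_of_mem {c : List Bool} {l : List (List Bool)} (h : c ∈ l) :
    c.length ≤ (body l).length := by
  rw [← frames_eq_body]; exact length_le_length_frames_of_mem h

/-- Unfolding `encodingFinVec` into a pair of the unary length and the framed item codes. [cite: AroraBarakCC2009, §0.1] -/
theorem finVec_encode_eq_boolPair {α : Type} (e : Encoding α Bool) (m : ℕ) (v : Fin m → α) :
    (encodingFinVec e m).encode v = boolPair (ones m) (frames (List.ofFn fun i => e.encode (v i))) := by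
  rw [finVec_encode_eq, boolPair_eq, OracleCompose.unaryEncodeNat_eq_replicate]

/-! ### `ℕ`-indexed arithmetic of the Gram completion -/

section Arith

variable (X : Fin n → Fin n → ℤ)

/-- The entry `X i j`, `0` off range. [folklore] -/
def xAt (i j : ℕ) : ℤ := if h : i < n ∧ j < n then X ⟨i, h.1⟩ ⟨j, h.2⟩ else 0

/-- `xAt` on range. [folklore] -/
theorem xAt_eq (i j : Fin n) : xAt X i j = X i j := by
  simp [xAt, i.isLt, j.isLt]

/-- The Gram entry `⟨x_a, x_b⟩ = Σ_i X i a · X i b` with natural indices. [folklore] -/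
def gramAt (a b : ℕ) : ℤ := ∑ i : Fin n, xAt X i a * xAt X i b

/-- `gramAt = colGram` on range. [folklore] -/
theorem gramAt_eq (a b : Fin n) : gramAt X a b = colGram (Matrix.of X) a b := by
  simp [gramAt, colGram, xAt_eq]

/-- The entries `x_{ia}`, `x_{ib}` have the same sign bit. [folklore] -/
def sameSign (i a b : ℕ) : Prop := decide (xAt X i a < 0) = decide (xAt X i b < 0)

/-- Equality of sign bits is decidable. [folklore] -/
instance (i a b : ℕ) : Decidable (sameSign X i a b) := by unfold sameSign; infer_instance

/-- The positive part of the Gram sum: products of equal-sign entries, by magnitude. [folklore] -/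
def gramP (a b : ℕ) : ℕ := ∑ i ∈ range n, if sameSign X i a b then (xAt X i a).natAbs * (xAt X i b).natAbs else 0

/-- The negative part of the Gram sum: products of opposite-sign entries, by magnitude. [folklore] -/
def gramQ (a b : ℕ) : ℕ := ∑ i ∈ range n, if sameSign X i a b then 0 else (xAt X i a).natAbs * (xAt X i b).natAbs

/-- A signed product by magnitudes and sign bits. [folklore] -/
theorem mul_eq_ite_natAbs (u v : ℤ) :
    u * v = if decide (u < 0) = decide (v < 0) then ((u.natAbs * v.natAbs : ℕ) : ℤ)
      else -((u.natAbs * v.natAbs : ℕ) : ℤ) := by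
  rw [Nat.cast_mul, Int.natCast_natAbs, Int.natCast_natAbs]
  rcases lt_or_ge u 0 with hu | hu <;> rcases lt_or_ge v 0 with hv | hv
  · rw [abs_of_neg hu, abs_of_neg hv, if_pos (by rw [decide_eq_true hu, decide_eq_true hv])]; ring
  · rw [abs_of_neg hu, abs_of_nonneg hv, if_neg (by rw [decide_eq_true hu, decide_eq_false (not_lt.2 hv)]; decide)]
    ring
  · rw [abs_of_nonneg hu, abs_of_neg hv, if_neg (by rw [decide_eq_false (not_lt.2 hu), decide_eq_true hv]; decide)]
    ring
  · rw [abs_of_nonneg hu, abs_of_nonneg hv, if_pos (by rw [decide_eq_false (not_lt.2 hu), decide_eq_false (not_lt.2 hv)])]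

/-- **The sign split of the Gram sum**: `⟨x_a, x_b⟩ = P - Q`. [folklore] -/
theorem gramAt_eq_sub (a b : ℕ) : gramAt X a b = (gramP X a b : ℤ) - (gramQ X a b : ℤ) := by
  unfold gramAt gramP gramQ sameSign
  rw [Fin.sum_univ_eq_sum_range (fun i => xAt X i a * xAt X i b) n]
  push_cast
  rw [← Finset.sum_sub_distrib]
  refine Finset.sum_congr rfl fun i _ => ?_
  rw [mul_eq_ite_natAbs]
  split_ifs <;> push_cast <;> ring

/-- The sign bit of a difference of naturals. [folklore] -/
theorem decide_sub_lt_zero (P Q : ℕ) : decide ((P : ℤ) - Q < 0) = decide (P < Q) := by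
  by_cases h : P < Q
  · rw [decide_eq_true h, decide_eq_true (by omega)]
  · rw [decide_eq_false h, decide_eq_false (by omega)]

/-- The magnitude of a difference of naturals, by truncated subtractions. [folklore] -/
theorem natAbs_sub_eq (P Q : ℕ) : ((P : ℤ) - Q).natAbs = (P - Q) + (Q - P) := by
  omega

/-- **The integer code of `P - Q` from `P` and `Q`** (how the machine writes a signed Gram entry). [folklore] -/
theorem intCode_sub (P Q : ℕ) :
    intCode ((P : ℤ) - Q) = boolPair [decide (P < Q)] (encodeNat ((P - Q) + (Q - P))) := by
  rw [intCode_eq, decide_sub_lt_zero, natAbs_sub_eq]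

/-- The diagonal Gram entry after the pair rows, with natural indices and as a natural number:
`|⟨x_a, x_a⟩| + Σ_k ([a < k] ⟨x_a,x_k⟩² + [k < a])`. [folklore] -/
def pairDiagN (a : ℕ) : ℕ :=
  (gramAt X a a).natAbs + ∑ k ∈ range n, if a < k then (gramAt X a k).natAbs ^ 2 else if k < a then 1 else 0

/-- `⟨x_a, x_a⟩ ≥ 0`. [folklore] -/
theorem gramAt_self_nonneg (a : ℕ) : 0 ≤ gramAt X a a :=
  Finset.sum_nonneg fun _ _ => mul_self_nonneg _

/-- `pairDiagN = pairDiag` on range. [folklore] -/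
theorem pairDiagN_eq (a : Fin n) : (pairDiagN X a : ℤ) = pairDiag (Matrix.of X) a := by
  have h1 : ∀ k : Fin n, colGram (Matrix.of X) a k = gramAt X a k := fun k => (gramAt_eq X a k).symm
  unfold pairDiagN pairDiag
  simp only [h1, Nat.cast_add, Nat.cast_sum, Nat.cast_ite, Nat.cast_pow, Int.natCast_natAbs,
    abs_of_nonneg (gramAt_self_nonneg X a), Nat.cast_one, Nat.cast_zero, sq_abs, Fin.lt_def]
  rw [Fin.sum_univ_eq_sum_range (fun k => if (a : ℕ) < k then gramAt X a k ^ 2 else (0 : ℤ)) n,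
    Fin.sum_univ_eq_sum_range (fun k => if k < (a : ℕ) then (1 : ℤ) else 0) n, add_assoc,
    ← Finset.sum_add_distrib]
  congr 1
  refine Finset.sum_congr rfl fun k _ => ?_
  by_cases hak : (a : ℕ) < k
  · rw [if_pos hak, if_pos hak, if_neg (by omega), add_zero]
  · rw [if_neg hak, if_neg hak, zero_add]

/-- The deficit of column `a` at precision `t`, with natural indices: `4^t - pairDiagN a`. [folklore] -/
def deficitN (t a : ℕ) : ℕ := 4 ^ t - pairDiagN X a

/-- `deficitN = gramDeficit` on range. [folklore] -/
theorem deficitN_eq (t : ℕ) (a : Fin n) : deficitN X t a = gramDeficit (Matrix.of X) t a := by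
  unfold deficitN gramDeficit
  rw [← pairDiagN_eq, show (4 : ℤ) ^ t = ((4 ^ t : ℕ) : ℤ) by push_cast; rfl, Int.toNat_sub]

/-! ### The three kinds of cells -/

/-- Cells of the block `X`: `X i j`. [folklore] -/
def cellXv (i j : ℕ) : ℤ := xAt X i j

/-- Cells of the pair row `(a, b)`: for `a < b`, `⟨x_a, x_b⟩` in column `a`, `-1` in column `b`,
`0` elsewhere; zero rows for `a ≥ b`. [folklore] -/
def cellPv (a b j : ℕ) : ℤ :=
  if a < b then (if j = a then gramAt X a b else if j = b then -1 else 0) else 0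

/-- Cells of the private row `(a, lvl, l)`: `2^{lvl}` in column `a` when `l` is below the `lvl`-th
base-`4` digit of the deficit of column `a`, `0` elsewhere. [folklore] -/
def cellVv (t a lvl l j : ℕ) : ℤ :=
  if j = a ∧ l < base4Digit (deficitN X t a) lvl then 2 ^ lvl else 0

/-- `gramRows` on the block `X`. [folklore] -/
theorem gramRows_inl (t : ℕ) (i j : Fin n) : gramRows (Matrix.of X) t (Sum.inl i) j = cellXv X i j := by
  simp [gramRows, cellXv, xAt_eq]

/-- `gramRows` on a pair row. [folklore] -/
theorem gramRows_pair (t : ℕ) (a b j : Fin n) :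
    gramRows (Matrix.of X) t (Sum.inr (Sum.inl (a, b))) j = cellPv X a b j := by
  simp only [gramRows, cellPv, Fin.lt_def, ← gramAt_eq, Fin.ext_iff]

/-- `gramRows` on a private row. [folklore] -/
theorem gramRows_priv (t : ℕ) (a j : Fin n) (lvl : Fin (t + 1)) (l : Fin 3) :
    gramRows (Matrix.of X) t (Sum.inr (Sum.inr (a, (lvl, l)))) j = cellVv X t a lvl l j := by
  simp only [gramRows, cellVv, ← deficitN_eq, Fin.ext_iff]

/-! ### Row frames and the three row blocks -/

/-- The frame of the row with cells `c 0, …, c (n-1)`: `⟨⟨1ⁿ, frames of the cell codes⟩, ε⟩`. [folklore] -/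
def rowFrame (n : ℕ) (c : ℕ → ℤ) : List Bool :=
  frame1 (boolPair (ones n) (ccat (fun j => frame1 (cellCode (c j))) n))

/-- The row frame is the frame of the `encodingFinVec` code of the row. [folklore] -/
theorem rowFrame_eq (c : ℕ → ℤ) :
    rowFrame n c = frame1 ((encodingFinVec (encodingIntBool.pairBool encodingIntBool) n).encode fun j => (c j, 0)) := by
  rw [rowFrame, finVec_encode_eq_boolPair]
  simp only [pairInt_encode]
  rw [frames_ofFn_eq_ccat (fun j => cellCode (c j)) n]

/-- The block `X`: the frames of its `n` rows. [folklore] -/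
def partXs : List Bool := ccat (fun i => rowFrame n (cellXv X i)) n

/-- The pair rows, `(a, b)` in row-major order. [folklore] -/
def partPs : List Bool := ccat (fun a => ccat (fun b => rowFrame n (cellPv X a b)) n) n

/-- The private rows, `(a, lvl, l)` nested in that order. [folklore] -/
def partVs (t : ℕ) : List Bool :=
  ccat (fun a => ccat (fun lvl => ccat (fun l => rowFrame n (cellVv X t a lvl l)) 3) (t + 1)) n

end Arith

/-! ### The instance code as a concatenation of the three row blocks -/

section Instance

variable (X : Fin n → Fin n → ℤ)

/-- The cell-pair encoding of a row of the instance. [folklore] -/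
abbrev PP : Encoding (ℤ × ℤ) Bool := encodingIntBool.pairBool encodingIntBool

/-- The `encodingFinVec` code of row `r` of the instance at precision `t`. [folklore] -/
def rowEnc (t : ℕ) (r : Fin (n + gramExtra n t)) : List Bool :=
  (encodingFinVec PP n).encode (gramEntries (Matrix.of X) t r)

/-- Unfolding `gramInstanceCode` down to the list of row codes. [folklore] -/
theorem gramInstanceCode_unfold (t : ℕ) : gramInstanceCode (Matrix.of X) t =
    boolPair (encodeNat n) (boolPair (encodeNat (gramExtra n t)) (boolPair (encodeNat t)
      (boolPair (ones (n + gramExtra n t)) (frames (List.ofFn fun r => rowEnc X t r))))) := by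
  change boolPair (encodeNat n) (boolPair (encodeNat (gramExtra n t)) (boolPair (encodeNat t)
    ((encodingFinVec (encodingFinVec PP n) (n + gramExtra n t)).encode (gramEntries (Matrix.of X) t)))) = _
  rw [finVec_encode_eq_boolPair]
  rfl

/-- The row code of a row whose cells are given by an `ℕ`-indexed function is its `rowFrame`, unframed. [folklore] -/
theorem frame1_encode_cells (c : ℕ → ℤ) :
    frame1 ((encodingFinVec PP n).encode fun j : Fin n => (c j, (0 : ℤ))) = rowFrame n c :=
  (rowFrame_eq c).symm

/-- Row `castAdd i` is row `i` of the block `X`. [folklore] -/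
theorem rowEnc_castLE (t : ℕ) (i : Fin n) :
    rowEnc X t (Fin.castLE (Nat.le_add_right n (gramExtra n t)) i) =
      (encodingFinVec PP n).encode fun j : Fin n => (cellXv X i j, (0 : ℤ)) := by
  unfold rowEnc gramEntries
  have h : (gramRowEquiv n t).symm (Fin.castLE (Nat.le_add_right n (gramExtra n t)) i) = Sum.inl i :=
    (Equiv.symm_apply_eq _).2 (gramRowEquiv_inl n t i).symm
  simp only [h, gramRows_inl]

/-- The index of the pair row `(a, b)`. [folklore] -/
theorem gramRowEquiv_pair (t : ℕ) (a b : Fin n) (h : (a : ℕ) * n + b < n * n) :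
    gramRowEquiv n t (Sum.inr (Sum.inl (a, b))) =
      Fin.natAdd n (Fin.castAdd (n * ((t + 1) * 3)) ⟨a * n + b, h⟩) := by
  apply Fin.ext
  rw [Fin.val_natAdd, Fin.val_castAdd]
  change n + ((b : ℕ) + n * a) = _
  simp only; ring

/-- The index of the private row `(a, lvl, l)`. [folklore] -/
theorem gramRowEquiv_priv (t : ℕ) (a : Fin n) (lvl : Fin (t + 1)) (l : Fin 3)
    (h : (a : ℕ) * ((t + 1) * 3) + ((lvl : ℕ) * 3 + l) < n * ((t + 1) * 3)) :
    gramRowEquiv n t (Sum.inr (Sum.inr (a, (lvl, l)))) =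
      Fin.natAdd n (Fin.natAdd (n * n) ⟨a * ((t + 1) * 3) + (lvl * 3 + l), h⟩) := by
  apply Fin.ext
  rw [Fin.val_natAdd, Fin.val_natAdd]
  change n + (n * n + (((l : ℕ) + 3 * lvl) + (t + 1) * 3 * a)) = _
  simp only; ring

/-- Row `n + (a n + b)` is the pair row `(a, b)`. [folklore] -/
theorem rowEnc_pair (t : ℕ) (a b : Fin n) (h : (a : ℕ) * n + b < n * n) :
    rowEnc X t (Fin.natAdd n (Fin.castAdd (n * ((t + 1) * 3)) ⟨a * n + b, h⟩)) =
      (encodingFinVec PP n).encode fun j : Fin n => (cellPv X a b j, (0 : ℤ)) := by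
  unfold rowEnc gramEntries
  have h' : (gramRowEquiv n t).symm (Fin.natAdd n (Fin.castAdd (n * ((t + 1) * 3)) ⟨a * n + b, h⟩)) =
      Sum.inr (Sum.inl (a, b)) :=
    (Equiv.symm_apply_eq _).2 (gramRowEquiv_pair t a b h).symm
  simp only [h', gramRows_pair]

/-- Row `n + (n² + (3(t+1) a + 3 lvl + l))` is the private row `(a, lvl, l)`. [folklore] -/
theorem rowEnc_priv (t : ℕ) (a : Fin n) (lvl : Fin (t + 1)) (l : Fin 3)
    (h : (a : ℕ) * ((t + 1) * 3) + ((lvl : ℕ) * 3 + l) < n * ((t + 1) * 3)) :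
    rowEnc X t (Fin.natAdd n (Fin.natAdd (n * n) ⟨a * ((t + 1) * 3) + (lvl * 3 + l), h⟩)) =
      (encodingFinVec PP n).encode fun j : Fin n => (cellVv X t a lvl l j, (0 : ℤ)) := by
  unfold rowEnc gramEntries
  have h' : (gramRowEquiv n t).symm (Fin.natAdd n (Fin.natAdd (n * n) ⟨a * ((t + 1) * 3) + (lvl * 3 + l), h⟩)) =
      Sum.inr (Sum.inr (a, (lvl, l))) :=
    (Equiv.symm_apply_eq _).2 (gramRowEquiv_priv t a lvl l h).symm
  simp only [h', gramRows_priv]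

/-- The block `X` of the row list. [folklore] -/
theorem frames_rows_X (t : ℕ) :
    frames (List.ofFn fun i : Fin n => rowEnc X t (Fin.castLE (Nat.le_add_right n (gramExtra n t)) i)) = partXs X := by
  simp only [rowEnc_castLE]
  rw [frames_ofFn_eq_ccat (fun i => (encodingFinVec PP n).encode fun j : Fin n => (cellXv X i j, (0 : ℤ))) n]
  simp only [frame1_encode_cells]
  rfl

/-- The pair rows of the row list. [folklore] -/
theorem frames_rows_pair (t : ℕ) :
    frames (List.ofFn fun s : Fin (n * n) => rowEnc X t (Fin.natAdd n (Fin.castAdd _ s))) = partPs X := by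
  rw [List.ofFn_mul, frames_flatten, List.map_ofFn]
  refine flatten_ofFn_eq_ccat' fun a => ?_
  simp only [Function.comp_apply, rowEnc_pair]
  rw [frames_ofFn_eq_ccat (fun b => (encodingFinVec PP n).encode fun j : Fin n => (cellPv X a b j, (0 : ℤ))) n]
  simp only [frame1_encode_cells]

/-- The private rows of the row list. [folklore] -/
theorem frames_rows_priv (t : ℕ) :
    frames (List.ofFn fun s : Fin (n * ((t + 1) * 3)) => rowEnc X t (Fin.natAdd n (Fin.natAdd (n * n) s))) =
      partVs X t := by
  rw [List.ofFn_mul, frames_flatten, List.map_ofFn]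
  refine flatten_ofFn_eq_ccat' fun a => ?_
  simp only [Function.comp_apply]
  rw [List.ofFn_mul, frames_flatten, List.map_ofFn]
  refine flatten_ofFn_eq_ccat' fun lvl => ?_
  simp only [Function.comp_apply, rowEnc_priv]
  rw [frames_ofFn_eq_ccat (fun l => (encodingFinVec PP n).encode fun j : Fin n => (cellVv X t a lvl l j, (0 : ℤ))) 3]
  simp only [frame1_encode_cells]

/-- **The instance code as a string**: headers, the unary row count, and the three row blocks. [folklore] -/
theorem gramInstanceCode_eq (t : ℕ) : gramInstanceCode (Matrix.of X) t =
    boolPair (encodeNat n) (boolPair (encodeNat (gramExtra n t)) (boolPair (encodeNat t)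
      (boolPair (ones (n + gramExtra n t)) (partXs X ++ partPs X ++ partVs X t)))) := by
  rw [gramInstanceCode_unfold, List.ofFn_add, frames_append, frames_rows_X]
  have hsplit : (List.ofFn fun s : Fin (gramExtra n t) => rowEnc X t (Fin.natAdd n s)) =
      (List.ofFn fun s : Fin (n * n) => rowEnc X t (Fin.natAdd n (Fin.castAdd _ s))) ++
        List.ofFn fun s : Fin (n * ((t + 1) * 3)) => rowEnc X t (Fin.natAdd n (Fin.natAdd (n * n) s)) := by
    change (List.ofFn fun s : Fin (n * n + n * ((t + 1) * 3)) => rowEnc X t (Fin.natAdd n s)) = _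
    rw [List.ofFn_add]
    rfl
  rw [hsplit, frames_append, frames_rows_pair, frames_rows_priv, List.append_assoc]

/-- **The outcome code as a string**: `⟨1ⁿ, frames of bin 0, …, bin (n-1)⟩`. [folklore] -/
theorem diagOutcomeCode_eq (t : ℕ) :
    diagOutcomeCode n t = boolPair (ones n) (ccat (fun i => frame1 (encodeNat i)) n) := by
  unfold diagOutcomeCode encodeBosonOutcome
  rw [finVec_encode_eq_boolPair, ← frames_ofFn_eq_ccat (fun i => encodeNat i) n]
  rfl

/-- **The matrix code of the query as nested pairs**: `⟨bin n, ⟨1ⁿ, body [row₀, …]⟩⟩` with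
`rowᵢ = ⟨1ⁿ, body [intCode (X i 0), …]⟩`. [folklore] -/
theorem encode_matrix_eq : encodingIntMatrix.encode ⟨n, X⟩ =
    boolPair (encodeNat n) (boolPair (ones n) (body (List.ofFn fun i : Fin n =>
      boolPair (ones n) (body (List.ofFn fun j : Fin n => intCode (X i j)))))) := by
  change boolPair (encodeNat n) ((encodingFinVec (encodingFinVec encodingIntBool n) n).encode X) = _
  rw [finVec_encode_eq_boolPair, frames_eq_body]
  congr 3
  refine List.ofFn_inj.2 (funext fun i => ?_)
  rw [finVec_encode_eq_boolPair, frames_eq_body]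

end Instance

/-! ### Sizes: the entries and `n` against the code length; `3 |⟨X⟩|` is an admissible precision -/

section Sizes

variable (X : Fin n → Fin n → ℤ)

/-- The length of the matrix code `⟨X⟩` of the query. [folklore] -/
def codeLen : ℕ := (encodingIntMatrix.encode ⟨n, X⟩).length

/-- `n ≤ |⟨X⟩|` (the unary row count is part of the code). [folklore] -/
theorem le_codeLen : n ≤ codeLen X := by
  rw [codeLen, encode_matrix_eq, length_boolPair, length_boolPair]
  simp only [ones, List.length_replicate]
  omega

/-- A row code is no longer than the matrix code. [folklore] -/
theorem length_row_le_codeLen (i : Fin n) :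
    (boolPair (ones n) (body (List.ofFn fun j : Fin n => intCode (X i j)))).length ≤ codeLen X := by
  have h := length_le_length_body_of_mem (l := List.ofFn fun i : Fin n =>
      boolPair (ones n) (body (List.ofFn fun j : Fin n => intCode (X i j))))
    (c := boolPair (ones n) (body (List.ofFn fun j : Fin n => intCode (X i j)))) (List.mem_ofFn.2 ⟨i, rfl⟩)
  rw [codeLen, encode_matrix_eq]
  simp only [length_boolPair] at h ⊢
  omega

/-- **An entry code is no longer than the matrix code.** [folklore] -/
theorem length_intCode_le_codeLen (i j : Fin n) : (intCode (X i j)).length ≤ codeLen X := by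
  refine le_trans ?_ (length_row_le_codeLen X i)
  rw [length_boolPair]
  have h := length_le_length_body_of_mem (l := List.ofFn fun j : Fin n => intCode (X i j))
    (c := intCode (X i j)) (List.mem_ofFn.2 ⟨j, rfl⟩)
  omega

/-- The magnitude numeral of an entry is shorter than the matrix code by `4`. [folklore] -/
theorem length_encodeNat_entry_le (i j : Fin n) : (encodeNat (X i j).natAbs).length + 4 ≤ codeLen X := by
  have h := length_intCode_le_codeLen X i j
  rwa [length_intCode] at h

/-- **Entries are below `2^{|⟨X⟩|}`.** [folklore] -/
theorem natAbs_entry_lt (i j : Fin n) : (X i j).natAbs < 2 ^ codeLen X := by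
  have h1 := length_encodeNat_entry_le X i j
  rw [TM2Pass.length_encodeNat_eq_size] at h1
  exact (Nat.lt_size_self _).trans_le (Nat.pow_le_pow_right (by norm_num) (by omega))

/-- **Gram entries are at most `n · 4^{|⟨X⟩|}` in absolute value.** [folklore] -/
theorem abs_colGram_le (a b : Fin n) :
    |colGram (Matrix.of X) a b| ≤ (n : ℤ) * 4 ^ codeLen X := by
  unfold colGram
  refine (Finset.abs_sum_le_sum_abs _ _).trans ?_
  have hb : ∀ i : Fin n, |Matrix.of X i a * Matrix.of X i b| ≤ (4 : ℤ) ^ codeLen X := by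
    intro i
    rw [abs_mul, Matrix.of_apply, Matrix.of_apply, show (4 : ℤ) ^ codeLen X = 2 ^ codeLen X * 2 ^ codeLen X by
      rw [← mul_pow]; norm_num]
    have ha : |X i a| ≤ (2 : ℤ) ^ codeLen X := by
      rw [← Int.natCast_natAbs]; exact_mod_cast (natAbs_entry_lt X i a).le
    have hb : |X i b| ≤ (2 : ℤ) ^ codeLen X := by
      rw [← Int.natCast_natAbs]; exact_mod_cast (natAbs_entry_lt X i b).le
    exact mul_le_mul ha hb (abs_nonneg _) (by positivity)
  calc ∑ i, |Matrix.of X i a * Matrix.of X i b| ≤ ∑ _i : Fin n, (4 : ℤ) ^ codeLen X :=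
        Finset.sum_le_sum fun i _ => hb i
    _ = (n : ℤ) * 4 ^ codeLen X := by rw [Finset.sum_const, Finset.card_univ, Fintype.card_fin]; simp

/-- `2 m + m³ ≤ 4^m`. [folklore] -/
theorem two_mul_add_pow_three_le_four_pow : ∀ m : ℕ, 2 * m + m ^ 3 ≤ 4 ^ m
  | 0 => by norm_num
  | 1 => by norm_num
  | m + 2 => by
    have ih := two_mul_add_pow_three_le_four_pow (m + 1)
    have h1 : 2 * (m + 2) + (m + 2) ^ 3 ≤ 4 * (2 * (m + 1) + (m + 1) ^ 3) := by ring_nf; omega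
    calc 2 * (m + 2) + (m + 2) ^ 3 ≤ 4 * (2 * (m + 1) + (m + 1) ^ 3) := h1
      _ ≤ 4 * 4 ^ (m + 1) := Nat.mul_le_mul_left 4 ih
      _ = 4 ^ (m + 2) := by ring

/-- **The precision `t = 3 |⟨X⟩|` dominates the deficits**: `pairDiag X j ≤ 4^{3 |⟨X⟩|}` for every
column `j` — the Gram entries are at most `n 4^{|⟨X⟩|}`, so `pairDiag X j ≤ n 4^L + n³ 4^{2L} + n ≤
4^n 4^{2L} ≤ 4^{3L}` (`n ≤ L = |⟨X⟩|`). This is exactly the admissibility hypothesis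
`∀ j, pairDiag X j ≤ 4^t` of `isColumnOrthonormal_gram` / `toReal_bosonSamplingProblem_gramInstance`
at `t = 3 |⟨X⟩|`, consumed by the *re-based* reduction of `BosonReductionMachine.lean` /
`BosonReductionAssembly.lean` (module docstring); it is unrelated to `bosonPre`, which is pinned to
`gramPrecision X`, and does not contribute to `bosonReduction_mem_FP`. [folklore] -/
theorem pairDiag_le_four_pow (j : Fin n) : pairDiag (Matrix.of X) j ≤ 4 ^ (3 * codeLen X) := by
  set L := codeLen X with hL
  set B : ℤ := 4 ^ L with hB
  have hB1 : 1 ≤ B := one_le_pow₀ (by norm_num)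
  have hnL : n ≤ L := le_codeLen X
  have hg : ∀ k : Fin n, |colGram (Matrix.of X) j k| ≤ (n : ℤ) * B := fun k => abs_colGram_le X j k
  have h1 : colGram (Matrix.of X) j j ≤ (n : ℤ) * B := (le_abs_self _).trans (hg j)
  have h2 : ∑ k : Fin n, (if j < k then colGram (Matrix.of X) j k ^ 2 else 0) ≤ (n : ℤ) * ((n : ℤ) * B) ^ 2 := by
    calc ∑ k : Fin n, (if j < k then colGram (Matrix.of X) j k ^ 2 else 0)
        ≤ ∑ _k : Fin n, ((n : ℤ) * B) ^ 2 := Finset.sum_le_sum fun k _ => by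
          split_ifs
          · calc colGram (Matrix.of X) j k ^ 2 = |colGram (Matrix.of X) j k| ^ 2 := (sq_abs _).symm
              _ ≤ ((n : ℤ) * B) ^ 2 := pow_le_pow_left₀ (abs_nonneg _) (hg k) 2
          · positivity
      _ = (n : ℤ) * ((n : ℤ) * B) ^ 2 := by rw [Finset.sum_const, Finset.card_univ, Fintype.card_fin]; simp
  have h3 : ∑ k : Fin n, (if k < j then (1 : ℤ) else 0) ≤ n := by
    calc ∑ k : Fin n, (if k < j then (1 : ℤ) else 0) ≤ ∑ _k : Fin n, (1 : ℤ) :=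
          Finset.sum_le_sum fun k _ => by split_ifs <;> norm_num
      _ = n := by simp
  have h4 : (2 * n + n ^ 3 : ℕ) ≤ 4 ^ L :=
    (two_mul_add_pow_three_le_four_pow n).trans (Nat.pow_le_pow_right (by norm_num) hnL)
  have h4' : (2 * (n : ℤ) + (n : ℤ) ^ 3) ≤ B := by rw [hB]; exact_mod_cast h4
  have hn0 : (0 : ℤ) ≤ n := Nat.cast_nonneg n
  calc pairDiag (Matrix.of X) j
      = colGram (Matrix.of X) j j + ∑ k : Fin n, (if j < k then colGram (Matrix.of X) j k ^ 2 else 0) +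
          ∑ k : Fin n, (if k < j then (1 : ℤ) else 0) := rfl
    _ ≤ (n : ℤ) * B + (n : ℤ) * ((n : ℤ) * B) ^ 2 + n := add_le_add (add_le_add h1 h2) h3
    _ ≤ (2 * (n : ℤ) + (n : ℤ) ^ 3) * B ^ 2 := by
        have hB2 : B ≤ B ^ 2 := by nlinarith
        have e1 : (n : ℤ) * B ≤ n * B ^ 2 := mul_le_mul_of_nonneg_left hB2 hn0
        have e2 : (n : ℤ) ≤ n * B ^ 2 := le_mul_of_one_le_right hn0 (by nlinarith)
        have e3 : (n : ℤ) * ((n : ℤ) * B) ^ 2 = (n : ℤ) ^ 3 * B ^ 2 := by ring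
        nlinarith [e1, e2, e3]
    _ ≤ B * B ^ 2 := mul_le_mul_of_nonneg_right h4' (by positivity)
    _ = 4 ^ (3 * L) := by rw [hB, ← pow_succ', ← pow_mul]; ring_nf

end Sizes

end BosonCodes

end Literature.Computability.QuantumComplexity
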